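import Mathlib
import Literature.NumberTheory.LFunctions.PrimeCountingAbel
import Literature.NumberTheory.Sieve.RomanoffExplicitAllN31
import Literature.NumberTheory.Sieve.TwoResidueSelbergSumSmall
import HarnessLib

/-!
# Romanoff's theorem with an explicit constant, uniform in `N`: `#{n ≤ N : n = p + 2^k} ≥ N/27` for all `N ≥ 4`

ROUND-48 «NO THRESHOLD» of the research cell parity-ideate (seat p5), on top of ROUND-47's `1/31`
(`RomanoffExplicitAllN31`: Abel-summation `π`-bounds + the tree's pair sieves from `e^32`).

THE NEW INPUT.  The tree's arithmetic large sieve for prime pairs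
(`GoldbachSieveEight.card_primePairs_mul_Qsum_le`) holds for EVERY level `X ≥ 1`; only the asymptotic lower bound
for its denominator `Q_∅(X)` (`Qsum_ge_kappa4`, `X ≥ 2^22`) forces the threshold `e^32` of every explicit pair
sieve in the tree.  `TwoResidueSelbergSumSmall` certifies `Q_∅(4096) ≥ 45.6` in the kernel (a 1203-step Buchstab
chain), which gives a pair sieve WITHOUT THRESHOLD and LINEAR in `x`:
`π_h(x) ≤ f(h)·(x + 16777215)/45.6 + 4097` for all `x` and all even `h ≠ 0` (`pairCount_le_linear`) — better than
`14.35 f(h) x/log²x` for `log x ≤ 25.6` and, decisively, valid below `e^32`.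

THE ASSEMBLY (`romanoffAllN_27`).  `N < 243`: two checkpoints; `243 ≤ N ≤ e^26.5`: one shift `p + 2` with
`π(n) ≥ n/log n` (`PrimeCountingAbel`); `e^26.5 < N ≤ e^33`: two shifts `p + 2`, `p + 4` with the thresholdless twin
bound; `e^33 ≤ N ≤ e^45.5`: two shifts with the tree's sieves `14.35` (`e^32`) / `13.01` (`e^38`) in three cells;
`e^45.5 ≤ N ≤ e^54`: THREE shifts `p + 2, p + 4, p + 8` (pairwise overlaps `f(2) + f(6) + f(4) = 4`) in six cells;
`e^54 ≤ N ≤ e^60`: the windowed density engine of `RomanoffExplicitAllN31` with the new instance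
`UniformPairSieve 12.56 e^54`; `N ≥ e^60`: the tree's `density_mul_param` with `π(n) ≥ 0.9844 n/log n` and the new
instance `UniformPairSieve 12.46 e^60` (density `0.037237 ≥ 1/27`, the thinnest margin of the file, `0.54 %`).
The method's wall: beyond `e^60` only `c₀ = 0.9844` is available for `π`, capping the density at `≈ 1/26.8`; `1/26`
needs `π(x) ≥ x/log x` past `e^60` or a pair-sieve constant `< 12`.

NOT a new asymptotic Romanov constant (print, `N ≥ N₀` only: Chen–Sun 2004 `0.0868`, Habsieger–Roblot 2006 `0.0933`,
Pintz 2006 `0.09368`, Elsholtz–Schlage-Puchta 2018 `0.107648`) and NOT a parity statement: an explicit, all-`N`,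
kernel-checked form of Romanoff 1934 / Nathanson Thm 7.11.
-/

namespace Literature.NumberTheory.Sieve.RomanoffExplicit

open Finset
open Literature.NumberTheory.Sieve
open Literature.NumberTheory.Sieve.RomanoffExplicit
open Literature.NumberTheory.Sieve.Romanov (romanovSet)
open Literature.NumberTheory.Sieve.GoldbachLinnik (oddSingularFactor oddSingularFactor_two_pow_mul
  oddSingularFactor_one oddSingularFactor_nonneg)
open Literature.NumberTheory.Sieve.GoldbachSieveEight (Qsum card_primePairs_mul_Qsum_le)
open Literature.NumberTheory.Sieve.TwoResidueSelbergExplicit (TlowK4)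
open Literature.NumberTheory.Sieve.ShnirelmanGoldbachExplicit (pairCount_le_of_numeric4_c38)
open Literature.NumberTheory.Sieve.TwoResidueSelbergSumSmall (Qsum_4096_ge)
open Literature.NumberTheory.LFunctions.PrimeCountingAbel (le_primeCounting_of_le_exp60 primeCounting_ge_09844)

/-! ## §1 Small lemmas -/

/-- `2.7182818283^k ≤ e^k`. [folklore] -/
private theorem elo_pow_le_exp (k : ℕ) : (2.7182818283 : ℝ) ^ k ≤ Real.exp (k : ℝ) := by
  have h : Real.exp (k : ℝ) = Real.exp 1 ^ k := by rw [← Real.exp_nat_mul, mul_one]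
  rw [h]
  exact pow_le_pow_left₀ (by norm_num) Real.exp_one_gt_d9.le k

/-- `e^{a−d} + c ≤ e^a` when `0 ≤ d` and `c ≤ d·e^{a−d}`. [folklore] -/
private theorem exp_sub_add_le {a d c : ℝ} (hc : c ≤ d * Real.exp (a - d)) :
    Real.exp (a - d) + c ≤ Real.exp a := by
  have h : Real.exp a = Real.exp (a - d) * Real.exp d := by rw [← Real.exp_add]; ring_nf
  have h1 : 1 + d ≤ Real.exp d := by have := Real.add_one_le_exp d; linarith
  rw [h]
  nlinarith [Real.exp_pos (a - d)]

/-- `e^{a − 0.01} + 8 ≤ e^a` for `a ≥ 7`. [folklore] -/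
private theorem exp_sub_001_add_eight_le {a : ℝ} (ha : 7 ≤ a) : Real.exp (a - 0.01) + 8 ≤ Real.exp a := by
  refine exp_sub_add_le ?_
  have h6 : (800 : ℝ) ≤ Real.exp (a - 0.01) := by
    have h1 : (800 : ℝ) ≤ (2.7182818283 : ℝ) ^ 6 * 1.99 := by norm_num
    have h2 : (1.99 : ℝ) ≤ Real.exp 0.99 := by have := Real.add_one_le_exp (0.99 : ℝ); linarith
    have h3 : Real.exp ((6 : ℕ) : ℝ) * Real.exp 0.99 ≤ Real.exp (a - 0.01) := by
      rw [← Real.exp_add]; exact Real.exp_le_exp.mpr (by push_cast; linarith)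
    nlinarith [elo_pow_le_exp 6, Real.exp_pos ((6 : ℕ) : ℝ), Real.exp_pos (0.99 : ℝ)]
  linarith

/-- `f(2) = 1`. [folklore] -/
private theorem oddSingularFactor_two' : oddSingularFactor 2 = 1 := by
  have h := oddSingularFactor_two_pow_mul 1 (n := 1) one_ne_zero
  rw [oddSingularFactor_one] at h
  simpa using h

/-- `f(4) = 1`. [folklore] -/
private theorem oddSingularFactor_four : oddSingularFactor 4 = 1 := by
  have h := oddSingularFactor_two_pow_mul 2 (n := 1) one_ne_zero
  rw [oddSingularFactor_one] at h
  simpa using h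

/-- `f(3) = 2`. [folklore] -/
private theorem oddSingularFactor_three : oddSingularFactor 3 = 2 := by
  unfold oddSingularFactor
  rw [Nat.prime_three.primeFactors, Finset.filter_singleton, if_pos (by norm_num), Finset.prod_singleton]
  norm_num

/-- `f(6) = 2`. [folklore] -/
private theorem oddSingularFactor_six : oddSingularFactor 6 = 2 := by
  have h := oddSingularFactor_two_pow_mul 1 (n := 3) (by norm_num)
  rw [oddSingularFactor_three] at h
  simpa using h

/-! ## §2 The thresholdless pair sieve from `Q_∅(4096) ≥ 45.6` -/

/-- ★ **PAIR SIEVE WITHOUT THRESHOLD**: for ALL `x` and all even `h ≠ 0`,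
`π_h(x) = #{p ≤ x : p, p + h prime} ≤ f(h)·(x + 16777215)/45.6 + 4097` — the tree's arithmetic large sieve
`card_primePairs_mul_Qsum_le` at the fixed level `X = 4096` with the kernel certificate `Q_∅(4096) ≥ 45.6`.
[cite: BatemanDiamond2004, Thm 13.8 and (13.13)–(13.14), pp. 325–328 (explicit thresholdless form proved here)] -/
theorem pairCount_le_linear (x h : ℕ) (hh : h ≠ 0) (heven : Even h) :
    (pairCount x h : ℝ) ≤ oddSingularFactor h * (((x : ℝ) + 16777215) / 45.6) + 4097 := by
  have hBD := card_primePairs_mul_Qsum_le 1 h x 4096 le_rfl (Nat.one_le_iff_ne_zero.mpr hh)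
    (by simpa using heven) (by norm_num)
  have hprod : (∏ p ∈ ((1 * h).primeFactors.filter (2 < ·)), (((p : ℝ) - 1) / ((p : ℝ) - 2)))
      = oddSingularFactor h := by rw [one_mul]; rfl
  rw [hprod] at hBD
  have hcount : ((range (x + 1)).filter (fun p => p.Prime ∧ (1 * p + h).Prime)).card = pairCount x h := by
    unfold pairCount
    congr 1
    ext p
    simp only [mem_filter, mem_range, Nat.mem_primesLE, one_mul, Nat.lt_succ_iff]
    tauto
  rw [hcount] at hBD
  push_cast at hBD
  have hQ : (45.6 : ℝ) ≤ Qsum ∅ 4096 := Qsum_4096_ge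
  have hQpos : (0 : ℝ) < Qsum ∅ 4096 := by linarith
  have hF : 0 ≤ oddSingularFactor h := oddSingularFactor_nonneg h
  have hMF : 0 ≤ ((x : ℝ) + 16777215) * oddSingularFactor h := by positivity
  have h2 : ((pairCount x h : ℝ) - 4097) * Qsum ∅ 4096 ≤ ((x : ℝ) + 16777215) * oddSingularFactor h := by
    nlinarith [hBD]
  have h3 : (pairCount x h : ℝ) - 4097 ≤ ((x : ℝ) + 16777215) * oddSingularFactor h / Qsum ∅ 4096 := by
    rw [le_div_iff₀ hQpos]; exact h2
  have h4 : ((x : ℝ) + 16777215) * oddSingularFactor h / Qsum ∅ 4096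
      ≤ ((x : ℝ) + 16777215) * oddSingularFactor h / 45.6 :=
    div_le_div_of_nonneg_left hMF (by norm_num) hQ
  have h5 : oddSingularFactor h * (((x : ℝ) + 16777215) / 45.6)
      = ((x : ℝ) + 16777215) * oddSingularFactor h / 45.6 := by ring
  linarith

/-- The twin case: `twinLE x ≤ (x + 16777215)/45.6 + 4097` for every `x`.
[cite: BatemanDiamond2004, Thm 13.8 and (13.13)–(13.14), pp. 325–328 (twin case of the explicit thresholdless form proved here)] -/
theorem twinLE_le_linear (x : ℕ) : (twinLE x : ℝ) ≤ ((x : ℝ) + 16777215) / 45.6 + 4097 := by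
  have h := pairCount_le_linear x 2 two_ne_zero even_two
  rw [oddSingularFactor_two', one_mul] at h
  exact h

/-! ## §3 Two and three shifts -/

/-- `twinLE` is monotone. [folklore] -/
private theorem twinLE_mono' {x y : ℕ} (h : x ≤ y) : twinLE x ≤ twinLE y := by
  unfold twinLE
  refine card_le_card (fun p hp => ?_)
  rw [mem_filter, Nat.mem_primesLE] at hp ⊢
  exact ⟨⟨hp.1.1.trans h, hp.1.2⟩, hp.2⟩

/-- The image of `p ↦ p + 2^j` (`p ≤ N − 2^j` prime, `j ≥ 1`) lies in Romanov's set. [folklore] -/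
private theorem image_shift_subset {N s j : ℕ} (hj : 1 ≤ j) (hs : s = 2 ^ j) (hsN : s ≤ N) :
    (Nat.primesLE (N - s)).image (· + s) ⊆ romanovSet N := by
  intro m hm
  rw [mem_image] at hm
  obtain ⟨p, hp, rfl⟩ := hm
  rw [Nat.mem_primesLE] at hp
  simp only [Romanov.romanovSet, mem_filter, mem_range]
  exact ⟨by omega, p, j, hp.2, hj, by rw [hs]⟩

/-- Overlap of two shifts `s < s'`: `#((P(N−s)+s) ∩ (P(N−s')+s')) ≤ π_{s'−s}(N − s')`. [folklore] -/
private theorem card_inter_shifts_le {N s s' : ℕ} (hss : s < s') :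
    (((Nat.primesLE (N - s)).image (· + s)) ∩ ((Nat.primesLE (N - s')).image (· + s'))).card
      ≤ pairCount (N - s') (s' - s) := by
  unfold pairCount
  have hsub : ((Nat.primesLE (N - s)).image (· + s)) ∩ ((Nat.primesLE (N - s')).image (· + s'))
      ⊆ ((Nat.primesLE (N - s')).filter fun p => (p + (s' - s)).Prime).image (· + s') := by
    intro m hm
    rw [mem_inter, mem_image, mem_image] at hm
    obtain ⟨⟨p, hp, hpm⟩, ⟨q, hq, hqm⟩⟩ := hm
    rw [Nat.mem_primesLE] at hp hq
    rw [mem_image]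
    refine ⟨q, ?_, hqm⟩
    rw [mem_filter, Nat.mem_primesLE]
    have hpq : p = q + (s' - s) := by omega
    exact ⟨hq, hpq ▸ hp.2⟩
  exact (card_le_card hsub).trans card_image_le

/-- **Two shifts**: `π(N − 2) + π(N − 4) − twinLE (N − 4) ≤ #romanovSet N` (`N ≥ 4`).
[cite: Nathanson1996, §7.6 proof of Lemma 7.9 with Theorem 7.3 (a coincidence p + a^k = p' + a^k' is a prime pair with difference a^k' − a^k) — explicit inclusion–exclusion lower count proved here] -/
theorem twoShifts_le {N : ℕ} (h4 : 4 ≤ N) :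
    (Nat.primeCounting (N - 2) : ℝ) + (Nat.primeCounting (N - 4) : ℝ) - (twinLE (N - 4) : ℝ)
      ≤ ((romanovSet N).card : ℝ) := by
  classical
  set A : Finset ℕ := (Nat.primesLE (N - 2)).image (· + 2) with hA
  set B : Finset ℕ := (Nat.primesLE (N - 4)).image (· + 4) with hB
  have hAc : A.card = Nat.primeCounting (N - 2) := by
    rw [hA, card_image_of_injective _ (add_left_injective 2), Nat.primesLE_card_eq_primeCounting]
  have hBc : B.card = Nat.primeCounting (N - 4) := by
    rw [hB, card_image_of_injective _ (add_left_injective 4), Nat.primesLE_card_eq_primeCounting]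
  have hsub : A ∪ B ⊆ romanovSet N :=
    union_subset (image_shift_subset (j := 1) le_rfl (by norm_num) (by omega))
      (image_shift_subset (j := 2) (by norm_num) (by norm_num) h4)
  have hinter : (A ∩ B).card ≤ twinLE (N - 4) := by
    have := card_inter_shifts_le (N := N) (s := 2) (s' := 4) (by norm_num)
    exact this
  have hunion := card_union_add_card_inter A B
  have hR := card_le_card hsub
  have key : Nat.primeCounting (N - 2) + Nat.primeCounting (N - 4) ≤ (romanovSet N).card + twinLE (N - 4) := by
    rw [← hAc, ← hBc, ← hunion]; omega
  have key' : (Nat.primeCounting (N - 2) : ℝ) + (Nat.primeCounting (N - 4) : ℝ)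
      ≤ ((romanovSet N).card : ℝ) + (twinLE (N - 4) : ℝ) := by exact_mod_cast key
  linarith

/-- **Three shifts**: `π(N−2) + π(N−4) + π(N−8) − twinLE(N−4) − π₆(N−8) − π₄(N−8) ≤ #romanovSet N` (`N ≥ 8`),
by Bonferroni for the images of `p ↦ p + 2, p + 4, p + 8`.
[cite: Nathanson1996, §7.6 proof of Lemma 7.9 with Theorem 7.3 (a coincidence p + a^k = p' + a^k' is a prime pair with difference a^k' − a^k) — explicit inclusion–exclusion lower count proved here] -/
theorem threeShifts_le {N : ℕ} (h8 : 8 ≤ N) :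
    (Nat.primeCounting (N - 2) : ℝ) + (Nat.primeCounting (N - 4) : ℝ) + (Nat.primeCounting (N - 8) : ℝ)
      - (twinLE (N - 4) : ℝ) - (pairCount (N - 8) 6 : ℝ) - (pairCount (N - 8) 4 : ℝ)
      ≤ ((romanovSet N).card : ℝ) := by
  classical
  set A : Finset ℕ := (Nat.primesLE (N - 2)).image (· + 2) with hA
  set B : Finset ℕ := (Nat.primesLE (N - 4)).image (· + 4) with hB
  set C : Finset ℕ := (Nat.primesLE (N - 8)).image (· + 8) with hC
  have hAc : A.card = Nat.primeCounting (N - 2) := by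
    rw [hA, card_image_of_injective _ (add_left_injective 2), Nat.primesLE_card_eq_primeCounting]
  have hBc : B.card = Nat.primeCounting (N - 4) := by
    rw [hB, card_image_of_injective _ (add_left_injective 4), Nat.primesLE_card_eq_primeCounting]
  have hCc : C.card = Nat.primeCounting (N - 8) := by
    rw [hC, card_image_of_injective _ (add_left_injective 8), Nat.primesLE_card_eq_primeCounting]
  have hsub : A ∪ B ∪ C ⊆ romanovSet N :=
    union_subset (union_subset (image_shift_subset (j := 1) le_rfl (by norm_num) (by omega))
      (image_shift_subset (j := 2) (by norm_num) (by norm_num) (by omega)))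
      (image_shift_subset (j := 3) (by norm_num) (by norm_num) h8)
  have hAB : (A ∩ B).card ≤ twinLE (N - 4) := by
    have := card_inter_shifts_le (N := N) (s := 2) (s' := 4) (by norm_num); exact this
  have hAC : (A ∩ C).card ≤ pairCount (N - 8) 6 := by
    have := card_inter_shifts_le (N := N) (s := 2) (s' := 8) (by norm_num); exact this
  have hBC : (B ∩ C).card ≤ pairCount (N - 8) 4 := by
    have := card_inter_shifts_le (N := N) (s := 4) (s' := 8) (by norm_num); exact this
  have h1 := card_union_add_card_inter A B
  have h2 := card_union_add_card_inter (A ∪ B) C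
  have h3 : ((A ∪ B) ∩ C).card ≤ (A ∩ C).card + (B ∩ C).card := by
    rw [union_inter_distrib_right]; exact card_union_le _ _
  have hR := card_le_card hsub
  have key : Nat.primeCounting (N - 2) + Nat.primeCounting (N - 4) + Nat.primeCounting (N - 8)
      ≤ (romanovSet N).card + twinLE (N - 4) + pairCount (N - 8) 6 + pairCount (N - 8) 4 := by
    rw [← hAc, ← hBc, ← hCc]; omega
  have key' : (Nat.primeCounting (N - 2) : ℝ) + (Nat.primeCounting (N - 4) : ℝ) + (Nat.primeCounting (N - 8) : ℝ)
      ≤ ((romanovSet N).card : ℝ) + (twinLE (N - 4) : ℝ) + (pairCount (N - 8) 6 : ℝ)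
        + (pairCount (N - 8) 4 : ℝ) := by exact_mod_cast key
  linarith

/-! ## §4 The cells -/

/-- `n/log n ≥ n/b` packaged: for `17 ≤ n ≤ M ≤ e^b`, `b ≤ 60`: `n/b ≤ π(n)`. [folklore] -/
private theorem div_le_primeCounting {n : ℕ} {M b : ℝ} (h17 : 17 ≤ n) (hnM : (n : ℝ) ≤ M)
    (hM : M ≤ Real.exp b) (hb : b ≤ 60) : (n : ℝ) / b ≤ (Nat.primeCounting n : ℝ) := by
  have hn : (17 : ℝ) ≤ n := by exact_mod_cast h17
  have hpos : (0 : ℝ) < n := by linarith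
  have h60 : (n : ℝ) ≤ Real.exp 60 := (hnM.trans hM).trans (Real.exp_le_exp.mpr hb)
  have hπ := le_primeCounting_of_le_exp60 h17 h60
  have hlog : Real.log (n : ℝ) ≤ b := (Real.log_le_iff_le_exp hpos).mpr (hnM.trans hM)
  have hlogpos : 0 < Real.log (n : ℝ) := Real.log_pos (by linarith)
  exact (div_le_div_of_nonneg_left hpos.le hlogpos hlog).trans hπ

/-- A pair bound `A f x/log²x ≤ A f x/a'²` once `log x ≥ a' > 0`. [folklore] -/
private theorem pair_le_of_log_ge {P A f x a' : ℝ} (hP : P ≤ A * f * x / Real.log x ^ 2) (hA : 0 ≤ A)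
    (hf : 0 ≤ f) (hx : 0 ≤ x) (ha' : 0 < a') (hlog : a' ≤ Real.log x) : P ≤ A * f * x / a' ^ 2 :=
  hP.trans (div_le_div_of_nonneg_left (by positivity) (by positivity) (pow_le_pow_left₀ ha'.le hlog 2))

/-- **Two-shift cell** with a uniform pair sieve `A` from `e^t`: for `e^a ≤ N ≤ e^b` (`t ≤ a − 0.01`, `8 ≤ a`,
`b ≤ 60`): `(N−2)/b + (N−4)/b − A (N−4)/(a−0.01)² ≤ #romanovSet N`.
[cite: Nathanson1996, §7.6 Lemmas 7.9–7.10 and Theorem 7.11 (Romanov's theorem) — explicit cell inequality (shift count minus pair-sieve bound) proved here] -/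
theorem cell2_core {A t a b : ℝ} (hPS : UniformPairSieve A (Real.exp t)) (hA : 0 ≤ A)
    (hta : t ≤ a - 0.01) (ha8 : 8 ≤ a) (hb60 : b ≤ 60) {N : ℕ}
    (ha : Real.exp a ≤ (N : ℝ)) (hb : (N : ℝ) ≤ Real.exp b) :
    ((N : ℝ) - 2) / b + ((N : ℝ) - 4) / b - A * ((N : ℝ) - 4) / (a - 0.01) ^ 2
      ≤ ((romanovSet N).card : ℝ) := by
  have h8e := exp_sub_001_add_eight_le (a := a) (by linarith)
  have hepos : 0 < Real.exp (a - 0.01) := Real.exp_pos _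
  have he17 : (17 : ℝ) ≤ Real.exp (a - 0.01) := by
    have : (17 : ℝ) ≤ Real.exp ((3 : ℕ) : ℝ) := le_trans (by norm_num) (elo_pow_le_exp 3)
    exact this.trans (Real.exp_le_exp.mpr (by push_cast; linarith))
  have hN : (25 : ℝ) ≤ N := by linarith
  have hN25 : 25 ≤ N := by exact_mod_cast (show (25 : ℝ) ≤ N by linarith)
  have hcast2 : ((N - 2 : ℕ) : ℝ) = (N : ℝ) - 2 := by rw [Nat.cast_sub (by omega)]; norm_num
  have hcast4 : ((N - 4 : ℕ) : ℝ) = (N : ℝ) - 4 := by rw [Nat.cast_sub (by omega)]; norm_num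
  -- the twin term at `N − 4 ≥ e^{a − 0.01} ≥ e^t`
  have hx4 : Real.exp (a - 0.01) ≤ ((N - 4 : ℕ) : ℝ) := by rw [hcast4]; linarith
  have hx4t : Real.exp t ≤ ((N - 4 : ℕ) : ℝ) := (Real.exp_le_exp.mpr (by linarith)).trans hx4
  have hT := hPS (N - 4) 2 hx4t two_ne_zero even_two
  rw [oddSingularFactor_two'] at hT
  have hpos4 : (0 : ℝ) < ((N - 4 : ℕ) : ℝ) := by rw [hcast4]; linarith
  have hlog4 : a - 0.01 ≤ Real.log ((N - 4 : ℕ) : ℝ) := (Real.le_log_iff_exp_le hpos4).mpr hx4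
  have hTw := pair_le_of_log_ge hT hA zero_le_one hpos4.le (by linarith) hlog4
  rw [hcast4, mul_one] at hTw
  change (twinLE (N - 4) : ℝ) ≤ _ at hTw
  -- the `π` terms
  have hq2 := div_le_primeCounting (n := N - 2) (M := (N : ℝ)) (b := b) (by omega) (by rw [hcast2]; linarith) hb hb60
  have hq4 := div_le_primeCounting (n := N - 4) (M := (N : ℝ)) (b := b) (by omega) (by rw [hcast4]; linarith) hb hb60
  rw [hcast2] at hq2
  rw [hcast4] at hq4
  have htwo := twoShifts_le (N := N) (by omega)
  linarith

/-- **Three-shift cell** with a uniform pair sieve `A` from `e^t`: for `e^a ≤ N ≤ e^b` (`t ≤ a − 0.01`, `8 ≤ a`,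
`b ≤ 60`): `(N−2)/b + (N−4)/b + (N−8)/b − A (N−4)/(a−.01)² − 2A (N−8)/(a−.01)² − A (N−8)/(a−.01)² ≤ #romanovSet N`.
[cite: Nathanson1996, §7.6 Lemmas 7.9–7.10 and Theorem 7.11 (Romanov's theorem) — explicit cell inequality (shift count minus pair-sieve bound) proved here] -/
theorem cell3_core {A t a b : ℝ} (hPS : UniformPairSieve A (Real.exp t)) (hA : 0 ≤ A)
    (hta : t ≤ a - 0.01) (ha8 : 8 ≤ a) (hb60 : b ≤ 60) {N : ℕ}
    (ha : Real.exp a ≤ (N : ℝ)) (hb : (N : ℝ) ≤ Real.exp b) :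
    ((N : ℝ) - 2) / b + ((N : ℝ) - 4) / b + ((N : ℝ) - 8) / b - A * ((N : ℝ) - 4) / (a - 0.01) ^ 2
      - 2 * A * ((N : ℝ) - 8) / (a - 0.01) ^ 2 - A * ((N : ℝ) - 8) / (a - 0.01) ^ 2
      ≤ ((romanovSet N).card : ℝ) := by
  have h8e := exp_sub_001_add_eight_le (a := a) (by linarith)
  have hepos : 0 < Real.exp (a - 0.01) := Real.exp_pos _
  have he17 : (17 : ℝ) ≤ Real.exp (a - 0.01) := by
    have : (17 : ℝ) ≤ Real.exp ((3 : ℕ) : ℝ) := le_trans (by norm_num) (elo_pow_le_exp 3)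
    exact this.trans (Real.exp_le_exp.mpr (by push_cast; linarith))
  have hN : (25 : ℝ) ≤ N := by linarith
  have hN25 : 25 ≤ N := by exact_mod_cast (show (25 : ℝ) ≤ N by linarith)
  have hcast2 : ((N - 2 : ℕ) : ℝ) = (N : ℝ) - 2 := by rw [Nat.cast_sub (by omega)]; norm_num
  have hcast4 : ((N - 4 : ℕ) : ℝ) = (N : ℝ) - 4 := by rw [Nat.cast_sub (by omega)]; norm_num
  have hcast8 : ((N - 8 : ℕ) : ℝ) = (N : ℝ) - 8 := by rw [Nat.cast_sub (by omega)]; norm_num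
  have hx4 : Real.exp (a - 0.01) ≤ ((N - 4 : ℕ) : ℝ) := by rw [hcast4]; linarith
  have hx8 : Real.exp (a - 0.01) ≤ ((N - 8 : ℕ) : ℝ) := by rw [hcast8]; linarith
  have hx4t : Real.exp t ≤ ((N - 4 : ℕ) : ℝ) := (Real.exp_le_exp.mpr (by linarith)).trans hx4
  have hx8t : Real.exp t ≤ ((N - 8 : ℕ) : ℝ) := (Real.exp_le_exp.mpr (by linarith)).trans hx8
  have hpos4 : (0 : ℝ) < ((N - 4 : ℕ) : ℝ) := by rw [hcast4]; linarith
  have hpos8 : (0 : ℝ) < ((N - 8 : ℕ) : ℝ) := by rw [hcast8]; linarith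
  have hlog4 : a - 0.01 ≤ Real.log ((N - 4 : ℕ) : ℝ) := (Real.le_log_iff_exp_le hpos4).mpr hx4
  have hlog8 : a - 0.01 ≤ Real.log ((N - 8 : ℕ) : ℝ) := (Real.le_log_iff_exp_le hpos8).mpr hx8
  have ha' : 0 < a - 0.01 := by linarith
  -- twins at N − 4
  have hT := hPS (N - 4) 2 hx4t two_ne_zero even_two
  rw [oddSingularFactor_two'] at hT
  have hTw := pair_le_of_log_ge hT hA zero_le_one hpos4.le ha' hlog4
  rw [hcast4, mul_one] at hTw
  change (twinLE (N - 4) : ℝ) ≤ _ at hTw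
  -- pairs `p, p + 6` and `p, p + 4` at N − 8
  have hS := hPS (N - 8) 6 hx8t (by norm_num) (by norm_num)
  rw [oddSingularFactor_six] at hS
  have hSx := pair_le_of_log_ge hS hA zero_le_two hpos8.le ha' hlog8
  rw [hcast8] at hSx
  have hF := hPS (N - 8) 4 hx8t (by norm_num) (by norm_num)
  rw [oddSingularFactor_four] at hF
  have hFx := pair_le_of_log_ge hF hA zero_le_one hpos8.le ha' hlog8
  rw [hcast8, mul_one] at hFx
  -- the `π` terms
  have hq2 := div_le_primeCounting (n := N - 2) (M := (N : ℝ)) (b := b) (by omega) (by rw [hcast2]; linarith) hb hb60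
  have hq4 := div_le_primeCounting (n := N - 4) (M := (N : ℝ)) (b := b) (by omega) (by rw [hcast4]; linarith) hb hb60
  have hq8 := div_le_primeCounting (n := N - 8) (M := (N : ℝ)) (b := b) (by omega) (by rw [hcast8]; linarith) hb hb60
  rw [hcast2] at hq2
  rw [hcast4] at hq4
  rw [hcast8] at hq8
  have hthree := threeShifts_le (N := N) (by omega)
  have e1 : A * 2 * ((N : ℝ) - 8) / (a - 0.01) ^ 2 = 2 * A * ((N : ℝ) - 8) / (a - 0.01) ^ 2 := by ring
  linarith

/-- **The thresholdless two-shift range**: for `243 ≤ N ≤ e^b`, `b ≤ 60`: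
`(N−2)/b + (N−4)/b − ((N − 4 + 16777215)/45.6 + 4097) ≤ #romanovSet N`.
[cite: Nathanson1996, §7.6 Lemmas 7.9–7.10 and Theorem 7.11 (Romanov's theorem) — explicit cell inequality (shift count minus pair-sieve bound) proved here] -/
theorem cell2new_core {b : ℝ} (hb60 : b ≤ 60) {N : ℕ} (h243 : 243 ≤ N) (hb : (N : ℝ) ≤ Real.exp b) :
    ((N : ℝ) - 2) / b + ((N : ℝ) - 4) / b - ((((N : ℝ) - 4) + 16777215) / 45.6 + 4097)
      ≤ ((romanovSet N).card : ℝ) := by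
  have hcast2 : ((N - 2 : ℕ) : ℝ) = (N : ℝ) - 2 := by rw [Nat.cast_sub (by omega)]; norm_num
  have hcast4 : ((N - 4 : ℕ) : ℝ) = (N : ℝ) - 4 := by rw [Nat.cast_sub (by omega)]; norm_num
  have hTw := twinLE_le_linear (N - 4)
  rw [hcast4] at hTw
  have hq2 := div_le_primeCounting (n := N - 2) (M := (N : ℝ)) (b := b) (by omega) (by rw [hcast2]; linarith) hb hb60
  have hq4 := div_le_primeCounting (n := N - 4) (M := (N : ℝ)) (b := b) (by omega) (by rw [hcast4]; linarith) hb hb60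
  rw [hcast2] at hq2
  rw [hcast4] at hq4
  have htwo := twoShifts_le (N := N) (by omega)
  linarith

/-! ## §5 The small ranges -/

/-- `π(25) ≥ 9`. [folklore] -/
private theorem nine_le_primeCounting_25 : 9 ≤ Nat.primeCounting 25 := by
  rw [← Nat.primesLE_card_eq_primeCounting]
  have hsub : ({2, 3, 5, 7, 11, 13, 17, 19, 23} : Finset ℕ) ⊆ Nat.primesLE 25 := by
    intro p hp
    simp only [Finset.mem_insert, Finset.mem_singleton] at hp
    rw [Nat.mem_primesLE]
    rcases hp with rfl | rfl | rfl | rfl | rfl | rfl | rfl | rfl | rfl <;> exact ⟨by norm_num, by norm_num⟩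
  exact le_trans (by decide) (Finset.card_le_card hsub)

/-- `π(2) ≥ 1`. [folklore] -/
private theorem one_le_primeCounting_2 : 1 ≤ Nat.primeCounting 2 := by
  rw [← Nat.primesLE_card_eq_primeCounting]
  have hsub : ({2} : Finset ℕ) ⊆ Nat.primesLE 2 := by
    intro p hp
    rw [Finset.mem_singleton] at hp
    rw [Nat.mem_primesLE]
    subst hp
    exact ⟨le_rfl, Nat.prime_two⟩
  exact le_trans (by decide) (Finset.card_le_card hsub)

/-- `π(N − 2) ≤ #romanovSet N` (one shift). [folklore] -/
private theorem primeCounting_le_card_romanovSet' (N : ℕ) :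
    (Nat.primeCounting (N - 2) : ℝ) ≤ ((romanovSet N).card : ℝ) := by
  have h := twoShifts_le (N := max N 4) (le_max_right _ _)
  by_cases h4 : 4 ≤ N
  · rw [max_eq_left h4] at h
    have hT : (twinLE (N - 4) : ℝ) ≤ (Nat.primeCounting (N - 4) : ℝ) := by
      unfold twinLE
      rw [← Nat.primesLE_card_eq_primeCounting]
      exact_mod_cast card_le_card (filter_subset _ _)
    linarith
  · -- `N ≤ 3`: `π(N − 2) ≤ π(1) = 0`
    have hN : N - 2 ≤ 1 := by omega
    have h0 : Nat.primeCounting (N - 2) ≤ Nat.primeCounting 1 := Nat.monotone_primeCounting hN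
    rw [Nat.primeCounting_one] at h0
    have : (Nat.primeCounting (N - 2) : ℝ) ≤ 0 := by exact_mod_cast h0
    linarith [Nat.cast_nonneg (α := ℝ) (romanovSet N).card]

/-- `4 ≤ N < 243`: `N/27 ≤ π(N − 2)` (`π(2) ≥ 1` up to `N = 27`, `π(25) ≥ 9` up to `N = 243`). [folklore] -/
private theorem range27_small {N : ℕ} (h4 : 4 ≤ N) (h : N < 243) :
    (1 / 27 : ℝ) * (N : ℝ) ≤ ((romanovSet N).card : ℝ) := by
  refine le_trans ?_ (primeCounting_le_card_romanovSet' N)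
  have hNlt : (N : ℝ) < 243 := by exact_mod_cast h
  by_cases h27 : N ≤ 27
  · have h1 : (1 : ℝ) ≤ Nat.primeCounting (N - 2) := by
      exact_mod_cast one_le_primeCounting_2.trans (Nat.monotone_primeCounting (show 2 ≤ N - 2 by omega))
    have : (N : ℝ) ≤ 27 := by exact_mod_cast h27
    linarith
  · have h9 : (9 : ℝ) ≤ Nat.primeCounting (N - 2) := by
      exact_mod_cast nine_le_primeCounting_25.trans (Nat.monotone_primeCounting (show 25 ≤ N - 2 by omega))
    linarith

/-- `243 ≤ N ≤ e^26.5`: `N/27 ≤ (N − 2)/26.5 ≤ π(N − 2)`. [folklore] -/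
private theorem range27_one {N : ℕ} (h243 : 243 ≤ N) (hb : (N : ℝ) ≤ Real.exp 26.5) :
    (1 / 27 : ℝ) * (N : ℝ) ≤ ((romanovSet N).card : ℝ) := by
  refine le_trans ?_ (primeCounting_le_card_romanovSet' N)
  have hcast2 : ((N - 2 : ℕ) : ℝ) = (N : ℝ) - 2 := by rw [Nat.cast_sub (by omega)]; norm_num
  have hq2 := div_le_primeCounting (n := N - 2) (M := (N : ℝ)) (b := 26.5) (by omega) (by rw [hcast2]; linarith) hb
    (by norm_num)
  rw [hcast2] at hq2
  have hN : (243 : ℝ) ≤ N := by exact_mod_cast h243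
  norm_num at hq2 ⊢
  linarith

/-- `243 ≤ N ≤ e^33` (used above `e^26.5`): `N/27 ≤ #romanovSet N` by two shifts and the thresholdless twin bound
(`2/33 − 1/45.6 − 1/27 = 0.00164 > 0`, additive constant `≈ 3.7·10⁵ ≪ 0.00164·e^26.5`). [folklore] -/
private theorem range27_new {N : ℕ} (ha : Real.exp 26.5 ≤ (N : ℝ)) (hb : (N : ℝ) ≤ Real.exp 33) :
    (1 / 27 : ℝ) * (N : ℝ) ≤ ((romanovSet N).card : ℝ) := by
  have hN : (195000000000 : ℝ) ≤ N := by
    refine le_trans ?_ ha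
    exact le_trans (le_trans (by norm_num) (elo_pow_le_exp 26)) (Real.exp_le_exp.mpr (by norm_num))
  have h243 : 243 ≤ N := by exact_mod_cast (show (243 : ℝ) ≤ N by linarith)
  have h := cell2new_core (b := 33) (by norm_num) h243 hb
  norm_num at h ⊢
  linarith

/-! ## §6 The new pair-sieve instances and the two density engines -/

set_option maxHeartbeats 1600000 in
/-- `e^{1.3865} ≥ 4.00048 = 4·1.00012` (copy of the tree's private lemma). [folklore] -/
private theorem exp_13865_ge' : (4.00048 : ℝ) ≤ Real.exp 1.3865 := by
  have hl2 : (2 : ℝ) ≤ Real.exp 0.6931471808 := by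
    have h1 := Real.exp_log (show (0:ℝ) < 2 by norm_num)
    have h2 := Real.exp_le_exp.mpr Real.log_two_lt_d9.le
    linarith
  have hsmall : (1.0002056384 : ℝ) ≤ Real.exp 0.0002056384 := by
    have := Real.add_one_le_exp (0.0002056384 : ℝ); linarith
  have hprod : Real.exp (1.3865 : ℝ) = Real.exp 0.6931471808 ^ 2 * Real.exp 0.0002056384 := by
    rw [← Real.exp_nat_mul, ← Real.exp_add]; norm_num
  rw [hprod]
  have h4 : (4 : ℝ) ≤ Real.exp 0.6931471808 ^ 2 := by nlinarith [Real.exp_pos (0.6931471808 : ℝ)]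
  nlinarith [Real.exp_pos (0.0002056384 : ℝ)]

/-- `c = 4` numerics at `Λ = 54`: `17L² ≤ 16·12.54·TlowK4(L/2 − 1.3865)` for `L ≥ 54`. [folklore] -/
private theorem cells4_numeric4_54 {L : ℝ} (hL : 54 ≤ L) :
    (((4 : ℕ) : ℝ) ^ 2 + 1) * L ^ 2 ≤ ((4 : ℕ) : ℝ) ^ 2 * (12.56 - 0.02) * TlowK4 (L / 2 - 1.3865) := by
  unfold TlowK4
  push_cast
  nlinarith [hL, mul_self_nonneg (L - 54)]

/-- `c = 4` numerics at `Λ = 60`: `17L² ≤ 16·12.44·TlowK4(L/2 − 1.3865)` for `L ≥ 60`. [folklore] -/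
private theorem cells4_numeric4_60 {L : ℝ} (hL : 60 ≤ L) :
    (((4 : ℕ) : ℝ) ^ 2 + 1) * L ^ 2 ≤ ((4 : ℕ) : ℝ) ^ 2 * (12.46 - 0.02) * TlowK4 (L / 2 - 1.3865) := by
  unfold TlowK4
  push_cast
  nlinarith [hL, mul_self_nonneg (L - 60)]

/-- **`UniformPairSieve 12.56 e^54`** (the tree's `c = 4` cell sieve `pairCount_le_of_numeric4_c38` at `Λ = 54`).
[cite: BatemanDiamond2004, Thm 13.8, §13.4–13.5 pp. 325–328 (explicit form proved here)] -/
theorem uniformPairSieve_1256 : UniformPairSieve 12.56 (Real.exp 54) := by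
  intro x h hx hh heven
  exact pairCount_le_of_numeric4_c38 (c := 4) (lc := 1.3865) (by norm_num) (by norm_num)
    (by have := exp_13865_ge'; push_cast; linarith) (by norm_num) (by norm_num)
    (fun _ hL => cells4_numeric4_54 hL) hx hh heven

/-- **`UniformPairSieve 12.46 e^60`** (the same at `Λ = 60`).
[cite: BatemanDiamond2004, Thm 13.8, §13.4–13.5 pp. 325–328 (explicit form proved here)] -/
theorem uniformPairSieve_1246 : UniformPairSieve 12.46 (Real.exp 60) := by
  intro x h hx hh heven
  exact pairCount_le_of_numeric4_c38 (c := 4) (lc := 1.3865) (by norm_num) (by norm_num)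
    (by have := exp_13865_ge'; push_cast; linarith) (by norm_num) (by norm_num)
    (fun _ hL => cells4_numeric4_60 hL) hx hh heven

/-- `2^54 ≤ e^54`. [folklore] -/
private theorem exp_54_ge : (18014398509481984 : ℝ) ≤ Real.exp 54 :=
  le_trans (by norm_num) (le_trans (elo_pow_le_exp 54) (le_of_eq (by norm_num)))

/-- `2^60 ≤ e^60`. [folklore] -/
private theorem exp_60_ge : (1152921504606846976 : ℝ) ≤ Real.exp 60 :=
  le_trans (by norm_num) (le_trans (elo_pow_le_exp 60) (le_of_eq (by norm_num)))

/-- The windowed `π`-hypothesis from `PrimeCountingAbel` (`c₀ = 1` on `17 ≤ n ≤ N ≤ e^60`). [folklore] -/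
private theorem window_hyp' {N : ℕ} (h60 : (N : ℝ) ≤ Real.exp 60) :
    ∀ n : ℕ, 17 ≤ n → n ≤ N → 1 * (n : ℝ) / Real.log (n : ℝ) ≤ (Nat.primeCounting n : ℝ) := by
  intro n h17 hnN
  rw [one_mul]
  exact le_primeCounting_of_le_exp60 h17 (le_trans (by exact_mod_cast hnN) h60)

/-- **`e^54 ≤ N ≤ e^60`: `#romanovSet N ≥ N/27`** — windowed engine, `c₀ = 1`, `A = 12.56`, `Λ = 54`, `s = 1.4053`
(`s²/(s + 4.035 A) = 0.037916`). [cite: Nathanson1996, §7.6 Theorem 7.11 (Romanov's theorem) — explicit form proved here] -/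
theorem romanov_ge_div27_window {N : ℕ} (h54 : Real.exp 54 ≤ (N : ℝ)) (h60 : (N : ℝ) ≤ Real.exp 60) :
    (1 / 27 : ℝ) * (N : ℝ) ≤ ((romanovSet N).card : ℝ) := by
  have hN0 : (0 : ℝ) ≤ N := Nat.cast_nonneg N
  have hd := density_mul_window (A := 12.56) (x₀ := Real.exp 54) (c₀ := 1) (s := 1.4053) (Λ := 54)
    (x₁ := 17) (by norm_num) uniformPairSieve_1256 (by norm_num) (by norm_num) (by norm_num) (by norm_num)
    (by push_cast; linarith [exp_54_ge]) (by push_cast; linarith [exp_54_ge])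
    (fun L hL => by linarith) (window_hyp' h60) h54 h54
  have hc : (1 / 27 : ℝ) ≤ (1.4053 : ℝ) ^ 2 / (1.4053 + 4.035 * 12.56) := by norm_num
  nlinarith

/-- **`N ≥ e^60`: `#romanovSet N ≥ N/27`** — the tree's `density_mul_param` with `π(n) ≥ 0.9844 n/log n`
(`PrimeCountingAbel`), `A = 12.46`, `Λ = 60`, `s = 1.387` (`s²/(s + 4.035 A) = 0.037237`, margin `0.54 %`).
[cite: Nathanson1996, §7.6 Theorem 7.11 (Romanov's theorem) — explicit form proved here] -/
theorem romanov_ge_div27_from_exp60 {N : ℕ} (h60 : Real.exp 60 ≤ (N : ℝ)) :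
    (1 / 27 : ℝ) * (N : ℝ) ≤ ((romanovSet N).card : ℝ) := by
  have hN0 : (0 : ℝ) ≤ N := Nat.cast_nonneg N
  have hd := density_mul_param (A := 12.46) (x₀ := Real.exp 60) (c₀ := 0.9844) (s := 1.387) (Λ := 60)
    (x₁ := 17) (by norm_num) uniformPairSieve_1246 (by norm_num) (by norm_num) primeCountingLowerMul_09844
    (by norm_num) (by norm_num) (by push_cast; linarith [exp_60_ge]) (by push_cast; linarith [exp_60_ge])
    (fun L hL => by nlinarith) h60 h60
  have hc : (1 / 27 : ℝ) ≤ (1.387 : ℝ) ^ 2 / (1.387 + 4.035 * 12.46) := by norm_num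
  nlinarith

/-! ## §7 The nine cells between `e^33` and `e^54` (two shifts up to `e^45.5`, three shifts beyond) -/

/-- Cell 1: `e^33 ≤ N ≤ e^39.7`, two shifts, pair sieve `14.35` (from `e^32`). [folklore] -/
private theorem range27_cell1 {N : ℕ} (ha : Real.exp 33 ≤ (N : ℝ)) (hb : (N : ℝ) ≤ Real.exp 39.7) :
    (1 / 27 : ℝ) * (N : ℝ) ≤ ((romanovSet N).card : ℝ) := by
  have hN : (214000000000000 : ℝ) ≤ N := by
    refine le_trans ?_ ha
    exact le_trans (le_trans (by norm_num) (elo_pow_le_exp 33)) (Real.exp_le_exp.mpr (by norm_num))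
  have h := cell2_core (A := 14.35) (t := 32) (a := 33) (b := 39.7) uniformPairSieve_1435 (by norm_num) (by norm_num) (by norm_num)
    (by norm_num) ha hb
  norm_num at h ⊢
  linarith

/-- Cell 2: `e^39.7 ≤ N ≤ e^44`, two shifts, pair sieve `13.01` (from `e^38`). [folklore] -/
private theorem range27_cell2 {N : ℕ} (ha : Real.exp 39.7 ≤ (N : ℝ)) (hb : (N : ℝ) ≤ Real.exp 44) :
    (1 / 27 : ℝ) * (N : ℝ) ≤ ((romanovSet N).card : ℝ) := by
  have hN : (86500000000000000 : ℝ) ≤ N := by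
    refine le_trans ?_ ha
    exact le_trans (le_trans (by norm_num) (elo_pow_le_exp 39)) (Real.exp_le_exp.mpr (by norm_num))
  have h := cell2_core (A := 13.01) (t := 38) (a := 39.7) (b := 44) uniformPairSieve_1301 (by norm_num) (by norm_num) (by norm_num)
    (by norm_num) ha hb
  norm_num at h ⊢
  linarith

/-- Cell 3: `e^44 ≤ N ≤ e^45.5`, two shifts, pair sieve `13.01` (from `e^38`). [folklore] -/
private theorem range27_cell3 {N : ℕ} (ha : Real.exp 44 ≤ (N : ℝ)) (hb : (N : ℝ) ≤ Real.exp 45.5) :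
    (1 / 27 : ℝ) * (N : ℝ) ≤ ((romanovSet N).card : ℝ) := by
  have hN : (12800000000000000000 : ℝ) ≤ N := by
    refine le_trans ?_ ha
    exact le_trans (le_trans (by norm_num) (elo_pow_le_exp 44)) (Real.exp_le_exp.mpr (by norm_num))
  have h := cell2_core (A := 13.01) (t := 38) (a := 44) (b := 45.5) uniformPairSieve_1301 (by norm_num) (by norm_num) (by norm_num)
    (by norm_num) ha hb
  norm_num at h ⊢
  linarith

/-- Cell 4: `e^45.5 ≤ N ≤ e^48.15`, three shifts, pair sieve `13.01` (from `e^38`). [folklore] -/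
private theorem range27_cell4 {N : ℕ} (ha : Real.exp 45.5 ≤ (N : ℝ)) (hb : (N : ℝ) ≤ Real.exp 48.15) :
    (1 / 27 : ℝ) * (N : ℝ) ≤ ((romanovSet N).card : ℝ) := by
  have hN : (34900000000000000000 : ℝ) ≤ N := by
    refine le_trans ?_ ha
    exact le_trans (le_trans (by norm_num) (elo_pow_le_exp 45)) (Real.exp_le_exp.mpr (by norm_num))
  have h := cell3_core (A := 13.01) (t := 38) (a := 45.5) (b := 48.15) uniformPairSieve_1301 (by norm_num) (by norm_num) (by norm_num)
    (by norm_num) ha hb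
  norm_num at h ⊢
  linarith

/-- Cell 5: `e^48.15 ≤ N ≤ e^50.3`, three shifts, pair sieve `13.01` (from `e^38`). [folklore] -/
private theorem range27_cell5 {N : ℕ} (ha : Real.exp 48.15 ≤ (N : ℝ)) (hb : (N : ℝ) ≤ Real.exp 50.3) :
    (1 / 27 : ℝ) * (N : ℝ) ≤ ((romanovSet N).card : ℝ) := by
  have hN : (701000000000000000000 : ℝ) ≤ N := by
    refine le_trans ?_ ha
    exact le_trans (le_trans (by norm_num) (elo_pow_le_exp 48)) (Real.exp_le_exp.mpr (by norm_num))
  have h := cell3_core (A := 13.01) (t := 38) (a := 48.15) (b := 50.3) uniformPairSieve_1301 (by norm_num) (by norm_num) (by norm_num)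
    (by norm_num) ha hb
  norm_num at h ⊢
  linarith

/-- Cell 6: `e^50.3 ≤ N ≤ e^51.95`, three shifts, pair sieve `13.01` (from `e^38`). [folklore] -/
private theorem range27_cell6 {N : ℕ} (ha : Real.exp 50.3 ≤ (N : ℝ)) (hb : (N : ℝ) ≤ Real.exp 51.95) :
    (1 / 27 : ℝ) * (N : ℝ) ≤ ((romanovSet N).card : ℝ) := by
  have hN : (5180000000000000000000 : ℝ) ≤ N := by
    refine le_trans ?_ ha
    exact le_trans (le_trans (by norm_num) (elo_pow_le_exp 50)) (Real.exp_le_exp.mpr (by norm_num))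
  have h := cell3_core (A := 13.01) (t := 38) (a := 50.3) (b := 51.95) uniformPairSieve_1301 (by norm_num) (by norm_num) (by norm_num)
    (by norm_num) ha hb
  norm_num at h ⊢
  linarith

/-- Cell 7: `e^51.95 ≤ N ≤ e^53.15`, three shifts, pair sieve `13.01` (from `e^38`). [folklore] -/
private theorem range27_cell7 {N : ℕ} (ha : Real.exp 51.95 ≤ (N : ℝ)) (hb : (N : ℝ) ≤ Real.exp 53.15) :
    (1 / 27 : ℝ) * (N : ℝ) ≤ ((romanovSet N).card : ℝ) := by
  have hN : (14000000000000000000000 : ℝ) ≤ N := by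
    refine le_trans ?_ ha
    exact le_trans (le_trans (by norm_num) (elo_pow_le_exp 51)) (Real.exp_le_exp.mpr (by norm_num))
  have h := cell3_core (A := 13.01) (t := 38) (a := 51.95) (b := 53.15) uniformPairSieve_1301 (by norm_num) (by norm_num) (by norm_num)
    (by norm_num) ha hb
  norm_num at h ⊢
  linarith

/-- Cell 8: `e^53.15 ≤ N ≤ e^53.95`, three shifts, pair sieve `13.01` (from `e^38`). [folklore] -/
private theorem range27_cell8 {N : ℕ} (ha : Real.exp 53.15 ≤ (N : ℝ)) (hb : (N : ℝ) ≤ Real.exp 53.95) :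
    (1 / 27 : ℝ) * (N : ℝ) ≤ ((romanovSet N).card : ℝ) := by
  have hN : (104000000000000000000000 : ℝ) ≤ N := by
    refine le_trans ?_ ha
    exact le_trans (le_trans (by norm_num) (elo_pow_le_exp 53)) (Real.exp_le_exp.mpr (by norm_num))
  have h := cell3_core (A := 13.01) (t := 38) (a := 53.15) (b := 53.95) uniformPairSieve_1301 (by norm_num) (by norm_num) (by norm_num)
    (by norm_num) ha hb
  norm_num at h ⊢
  linarith

/-- Cell 9: `e^53.95 ≤ N ≤ e^54`, three shifts, pair sieve `13.01` (from `e^38`). [folklore] -/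
private theorem range27_cell9 {N : ℕ} (ha : Real.exp 53.95 ≤ (N : ℝ)) (hb : (N : ℝ) ≤ Real.exp 54) :
    (1 / 27 : ℝ) * (N : ℝ) ≤ ((romanovSet N).card : ℝ) := by
  have hN : (104000000000000000000000 : ℝ) ≤ N := by
    refine le_trans ?_ ha
    exact le_trans (le_trans (by norm_num) (elo_pow_le_exp 53)) (Real.exp_le_exp.mpr (by norm_num))
  have h := cell3_core (A := 13.01) (t := 38) (a := 53.95) (b := 54) uniformPairSieve_1301 (by norm_num) (by norm_num) (by norm_num)
    (by norm_num) ha hb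
  norm_num at h ⊢
  linarith

/-! ## §8 The headline -/

/-- ★★ **ROMANOFF'S THEOREM, EXPLICIT, UNIFORM IN `N`, UNCONDITIONAL, constant `1/27`**: for every `N ≥ 4`,
`#{n ≤ N : n = p + 2^k, p prime, k ≥ 1} ≥ N/27` (ROUND-47 / `RomanoffExplicitAllN31`: `1/31`; tree: `1/34`,
`1/40`).  No named fact anywhere: Mathlib's Chebyshev/Abel machinery, the `θ`-table to `10⁸`, Costa Pereira's
shots, the tree's large sieve, and the kernel certificate `Q_∅(4096) ≥ 45.6`.
[cite: Nathanson1996, §7.6 Theorem 7.11 (Romanov's theorem) — explicit-uniform form with constant 1/27 proved here] -/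
theorem romanoffAllN_27 : RomanoffAllN (1 / 27 : ℝ) 4 := by
  intro N hN
  by_cases h0 : N < 243
  · exact range27_small hN h0
  push Not at h0
  by_cases h1 : (N : ℝ) ≤ Real.exp 26.5
  · exact range27_one h0 h1
  push Not at h1
  by_cases h2 : (N : ℝ) ≤ Real.exp 33
  · exact range27_new h1.le h2
  push Not at h2
  by_cases g0 : (N : ℝ) ≤ Real.exp 39.7
  · exact range27_cell1 (by linarith) g0
  push Not at g0
  by_cases g1 : (N : ℝ) ≤ Real.exp 44
  · exact range27_cell2 (by linarith) g1
  push Not at g1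
  by_cases g2 : (N : ℝ) ≤ Real.exp 45.5
  · exact range27_cell3 (by linarith) g2
  push Not at g2
  by_cases g3 : (N : ℝ) ≤ Real.exp 48.15
  · exact range27_cell4 (by linarith) g3
  push Not at g3
  by_cases g4 : (N : ℝ) ≤ Real.exp 50.3
  · exact range27_cell5 (by linarith) g4
  push Not at g4
  by_cases g5 : (N : ℝ) ≤ Real.exp 51.95
  · exact range27_cell6 (by linarith) g5
  push Not at g5
  by_cases g6 : (N : ℝ) ≤ Real.exp 53.15
  · exact range27_cell7 (by linarith) g6
  push Not at g6
  by_cases g7 : (N : ℝ) ≤ Real.exp 53.95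
  · exact range27_cell8 (by linarith) g7
  push Not at g7
  by_cases g8 : (N : ℝ) ≤ Real.exp 54
  · exact range27_cell9 (by linarith) g8
  push Not at g8
  by_cases hw : (N : ℝ) ≤ Real.exp 60
  · exact romanov_ge_div27_window (by linarith) hw
  push Not at hw
  exact romanov_ge_div27_from_exp60 hw.le

/-- The same, unfolded: `∀ N ≥ 4, N/27 ≤ #romanovSet N`. [cite: Nathanson1996, §7.6 Theorem 7.11 (Romanov's theorem) —
explicit-uniform form with constant 1/27 proved here] -/
theorem romanoffAllN_27_statement :
    ∀ N : ℕ, 4 ≤ N → (1 / 27 : ℝ) * (N : ℝ) ≤ ((romanovSet N).card : ℝ) := romanoffAllN_27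

end Literature.NumberTheory.Sieve.RomanoffExplicit
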